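import Summits.KontsevichZagierPeriods.KontsevichZagierPeriods.Theorems.RootDecompWalshStrataEtypeSectors
import Summits.KontsevichZagierPeriods.KontsevichZagierPeriods.Theorems.RootDecompWalshStrataEtypeCornerSector

/-!
# Root decomposition (Walsh strata), part 63 — E-type corners: from one sector to the whole plane, every wall list (gen 10, §63)

Route `RootDecompWalshStrata`, leaf `QuadricBakerDescent` (stmt-27597), residual R-Eθ.  Part 42
(`InBaker.of_Esector3/2/1/0`, `InBaker.of_Eplane`) verbatim with the hypothesis `q j ∈ goodWalls` REMOVED:
the sector stage now rests on the total sector theorem `InBaker.of_psector_cwalls'` (§62), and the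
cut-and-reflect stages (rule (1) along a null rational line through the centre + the moves `swap` / `negY` /
`negX` / `dil` of rule (2)) never used `goodWalls` except to transport it.
[KontsevichZagier2001 §1.2 rules (1)–(2); BCR1998 §2.2; this node]
-/

noncomputable section

open Set MeasureTheory MvPolynomial Literature.NumberTheory.Transcendental
open Literature.ModelTheory.ExponentialFields (IsSemialgebraic)

namespace Summit.KontsevichZagierPeriods.RootDecompWalshStrata.ConicDescent.BallCube

variable {κ₀ κ₁ : ℚ}

/-! #### 63.1 The sector `0 < Y < X`, every wall list -/

/-- **STAGE 3: an open piece of the sector `0 < Y < X`, every wall list** (= `InBaker.of_psector_cwalls'`,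
§62, with the closure as the closed set and the genuine replacement of the line list). [this node] -/
theorem InBaker.of_Esector3' (hκ : 0 < κ₀ ∧ 0 < κ₁) (γ a c : ℚ) (ha : a ≠ 0) {n m : ℕ} (ℓ : Fin n → Wall)
    (q : Fin m → Wall) (σ : KZ.IntegralRep 2) (hσo : IsOpen σ.domain)
    (hσT : σ.domain ⊆ {w | 0 < w 1 ∧ w 1 < w 0 ∧ (κ₀ : ℝ) * w 0 ^ 2 + κ₁ * w 1 ^ 2 < 1})
    (hD : ∀ w ∈ σ.domain, 0 < erad κ₀ κ₁ a c w)
    (hσi : ∀ w ∈ σ.domain, σ.integrand w = ellW κ₀ κ₁ γ a c w)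
    (hfr : ∀ w ∈ closure σ.domain, w ∉ σ.domain → w ∈ wallLocus (erad κ₀ κ₁ a c) ℓ q) :
    InBaker (KZ.of σ) := by
  classical
  set ℓ' : Fin n → Wall := fun i => if (ℓ i).k1 = 0 ∧ (ℓ i).k2 = 0 then ⟨0, 1, 0⟩ else ℓ i with hℓ'
  have hℓ0 : ∀ i, (ℓ' i).k0 = 0 → (ℓ' i).k1 ≠ 0 ∨ (ℓ' i).k2 ≠ 0 := by
    intro i _
    by_cases h : (ℓ i).k1 = 0 ∧ (ℓ i).k2 = 0
    · left
      rw [show ℓ' i = ⟨0, 1, 0⟩ from if_pos h]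
      exact one_ne_zero
    · rw [show ℓ' i = ℓ i from if_neg h]
      exact not_and_or.1 h
  have hQc : Continuous fun w : Fin 2 → ℝ => (κ₀ : ℝ) * w 0 ^ 2 + κ₁ * w 1 ^ 2 := by fun_prop
  have h1 : ∀ w ∈ closure σ.domain, 0 ≤ w 1 := fun w hw =>
    closure_minimal (fun v hv => show (0 : ℝ) ≤ v 1 from (hσT hv).1.le)
      (isClosed_le continuous_const (continuous_apply 1)) hw
  have h2 : ∀ w ∈ closure σ.domain, w 1 ≤ w 0 := fun w hw =>
    closure_minimal (fun v hv => show v 1 ≤ v 0 from (hσT hv).2.1.le)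
      (isClosed_le (continuous_apply 1) (continuous_apply 0)) hw
  have h3 : ∀ w ∈ closure σ.domain, (κ₀ : ℝ) * w 0 ^ 2 + κ₁ * w 1 ^ 2 ≤ 1 := fun w hw =>
    closure_minimal (fun v hv => show (κ₀ : ℝ) * v 0 ^ 2 + κ₁ * v 1 ^ 2 ≤ 1 from (hσT hv).2.2.le)
      (isClosed_le hQc continuous_const) hw
  exact InBaker.of_psector_cwalls' hκ γ a c ha ℓ' hℓ0 q σ hσo hσT hD hσi
    isClosed_closure subset_closure (fun w hw => ⟨h1 w hw, h2 w hw, h3 w hw⟩) fun w hwC hwT _ => by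
      rcases hfr w hwC hwT with h0 | ⟨i, hg, hi⟩ | ⟨j, hj⟩
      · exact Or.inl h0
      · refine Or.inr (Or.inl ⟨i, ?_⟩)
        rw [show ℓ' i = ℓ i from if_neg fun h => hg.elim (fun hk => hk h.1) fun hk => hk h.2]
        exact hi
      · exact Or.inr (Or.inr ⟨j, hj⟩)

/-! #### 63.2 The regions `{X, Y > 0}`, `{X > 0}`, `{Q < 1}` -/

/-- **STAGE 2: an open piece of the quadrant `{X > 0, Y > 0}`, every wall list** — cut along `X = Y`, the
upper half by the swap (`InBaker.of_Esector2` minus `goodWalls`). [KontsevichZagier2001 §1.2 rules (1)–(2); this node] -/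
theorem InBaker.of_Esector2' (hκ : 0 < κ₀ ∧ 0 < κ₁) (γ a c : ℚ) (ha : a ≠ 0) {n m : ℕ} (ℓ : Fin n → Wall)
    (q : Fin m → Wall) (σ : KZ.IntegralRep 2) (hσo : IsOpen σ.domain)
    (hσT : σ.domain ⊆ {w | 0 < w 0 ∧ 0 < w 1 ∧ (κ₀ : ℝ) * w 0 ^ 2 + κ₁ * w 1 ^ 2 < 1})
    (hD : ∀ w ∈ σ.domain, 0 < erad κ₀ κ₁ a c w)
    (hσi : ∀ w ∈ σ.domain, σ.integrand w = ellW κ₀ κ₁ γ a c w)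
    (hfr : ∀ w ∈ closure σ.domain, w ∉ σ.domain → w ∈ wallLocus (erad κ₀ κ₁ a c) ℓ q) :
    InBaker (KZ.of σ) := by
  set L : Wall := ⟨0, 1, -1⟩ with hLdef
  have hL : L.k1 ≠ 0 ∨ L.k2 ≠ 0 := Or.inl one_ne_zero
  have hLe : ∀ w : Fin 2 → ℝ, L.eval (w 0) (w 1) = w 0 - w 1 := fun w => by
    simp only [hLdef, Wall.eval]; push_cast; ring
  have hb : Bornology.IsBounded σ.domain := isBounded_of_subset_ell hκ fun w hw => (hσT hw).2.2
  refine InBaker.of_cut L hL σ (fun T hT hTr hTeq => ?_) fun T hT hTr hTeq => ?_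
  · -- `Y < X`
    subst hTeq
    refine InBaker.of_Esector3' hκ γ a c ha (Fin.cons L ℓ) q (σ.restrict _ hT hTr)
      (hσo.inter (isOpen_lt continuous_const L.continuous_eval)) (fun w hw => ?_) (fun w hw => hD w hw.1)
      (fun w hw => by rw [KZ.IntegralRep.integrand_restrict]; exact hσi w hw.1)
      (wallLocus_inter L hL (closure_pos_wall L) hfr)
    obtain ⟨⟨h0, h1, hQ⟩, hpos⟩ := And.intro (hσT hw.1) hw.2
    have hpos' : 0 < L.eval (w 0) (w 1) := hpos
    rw [hLe] at hpos'
    exact ⟨h1, by linarith, hQ⟩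
  · -- `X < Y`, by the swap
    subst hTeq
    have hTo : IsOpen (σ.domain ∩ {w | L.eval (w 0) (w 1) < 0}) :=
      hσo.inter (isOpen_lt L.continuous_eval continuous_const)
    obtain ⟨τ, hτd, hτi⟩ := exists_ellRep (AffMap.swap.isSemialgebraic_image hT)
      (AffMap.swap.isBounded_image (hb.subset hTr)) κ₁ κ₀ γ a c
    refine InBaker.of_swap κ₀ κ₁ γ a c (σ.restrict _ hT hTr) τ
      (by rw [hτd, KZ.IntegralRep.domain_restrict])
      (fun w hw => by rw [KZ.IntegralRep.integrand_restrict]; exact hσi w hw.1) hτi ?_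
    refine InBaker.of_Esector3' hκ.symm γ a c ha (fun i => ((Fin.cons L ℓ : Fin (n + 1) → Wall) i).swap)
      (fun j => (q j).swap) τ (by rw [hτd]; exact AffMap.swap.isOpen_image (by simp) hTo)
      ?_ ?_ hτi ?_
    · rw [hτd]
      rintro _ ⟨p, ⟨hp, hneg⟩, rfl⟩
      obtain ⟨h0, h1, hQ⟩ := hσT hp
      have hneg' : L.eval (p 0) (p 1) < 0 := hneg
      rw [hLe] at hneg'
      simp only [mem_setOf_eq, AffMap.swap_toFun_zero, AffMap.swap_toFun_one]
      exact ⟨h0, by linarith, by linarith⟩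
    · rw [hτd]
      rintro _ ⟨p, ⟨hp, -⟩, rfl⟩
      rw [erad_swap]
      exact hD p hp
    · rw [hτd]
      exact wallLocus_transport AffMap.swap (by simp) (erad_swap κ₀ κ₁ a c)
        (fun i p => ((Fin.cons L ℓ : Fin (n + 1) → Wall) i).swap_eval p)
        (fun i hg => Wall.swap_gen _ hg) (fun j p => (q j).swap_eval p)
        (wallLocus_inter L hL (closure_neg_wall L) hfr)

/-- **STAGE 1: an open piece of the half-plane `{X > 0}`, every wall list** — cut along `Y = 0`, the lower
half by `negY` (`InBaker.of_Esector1` minus `goodWalls`). [KontsevichZagier2001 §1.2 rules (1)–(2); this node] -/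
theorem InBaker.of_Esector1' (hκ : 0 < κ₀ ∧ 0 < κ₁) (γ a c : ℚ) (ha : a ≠ 0) {n m : ℕ} (ℓ : Fin n → Wall)
    (q : Fin m → Wall) (σ : KZ.IntegralRep 2) (hσo : IsOpen σ.domain)
    (hσT : σ.domain ⊆ {w | 0 < w 0 ∧ (κ₀ : ℝ) * w 0 ^ 2 + κ₁ * w 1 ^ 2 < 1})
    (hD : ∀ w ∈ σ.domain, 0 < erad κ₀ κ₁ a c w)
    (hσi : ∀ w ∈ σ.domain, σ.integrand w = ellW κ₀ κ₁ γ a c w)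
    (hfr : ∀ w ∈ closure σ.domain, w ∉ σ.domain → w ∈ wallLocus (erad κ₀ κ₁ a c) ℓ q) :
    InBaker (KZ.of σ) := by
  set L : Wall := ⟨0, 0, 1⟩ with hLdef
  have hL : L.k1 ≠ 0 ∨ L.k2 ≠ 0 := Or.inr one_ne_zero
  have hLe : ∀ w : Fin 2 → ℝ, L.eval (w 0) (w 1) = w 1 := fun w => by
    simp only [hLdef, Wall.eval]; push_cast; ring
  have hb : Bornology.IsBounded σ.domain := isBounded_of_subset_ell hκ fun w hw => (hσT hw).2
  refine InBaker.of_cut L hL σ (fun T hT hTr hTeq => ?_) fun T hT hTr hTeq => ?_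
  · -- `Y > 0`
    subst hTeq
    refine InBaker.of_Esector2' hκ γ a c ha (Fin.cons L ℓ) q (σ.restrict _ hT hTr)
      (hσo.inter (isOpen_lt continuous_const L.continuous_eval)) (fun w hw => ?_) (fun w hw => hD w hw.1)
      (fun w hw => by rw [KZ.IntegralRep.integrand_restrict]; exact hσi w hw.1)
      (wallLocus_inter L hL (closure_pos_wall L) hfr)
    obtain ⟨⟨h0, hQ⟩, hpos⟩ := And.intro (hσT hw.1) hw.2
    have hpos' : 0 < L.eval (w 0) (w 1) := hpos
    rw [hLe] at hpos'
    exact ⟨h0, hpos', hQ⟩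
  · -- `Y < 0`, by `negY`
    subst hTeq
    have hTo : IsOpen (σ.domain ∩ {w | L.eval (w 0) (w 1) < 0}) :=
      hσo.inter (isOpen_lt L.continuous_eval continuous_const)
    obtain ⟨τ, hτd, hτi⟩ := exists_ellRep (AffMap.negY.isSemialgebraic_image hT)
      (AffMap.negY.isBounded_image (hb.subset hTr)) κ₀ κ₁ γ a c
    refine InBaker.of_negY κ₀ κ₁ γ a c (σ.restrict _ hT hTr) τ
      (by rw [hτd, KZ.IntegralRep.domain_restrict])
      (fun w hw => by rw [KZ.IntegralRep.integrand_restrict]; exact hσi w hw.1) hτi ?_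
    refine InBaker.of_Esector2' hκ γ a c ha (fun i => ((Fin.cons L ℓ : Fin (n + 1) → Wall) i).negY)
      (fun j => (q j).negY) τ
      (by rw [hτd]; exact AffMap.negY.isOpen_image (by simp) hTo) ?_ ?_ hτi ?_
    · rw [hτd]
      rintro _ ⟨p, ⟨hp, hneg⟩, rfl⟩
      obtain ⟨h0, hQ⟩ := hσT hp
      have hneg' : L.eval (p 0) (p 1) < 0 := hneg
      rw [hLe] at hneg'
      simp only [mem_setOf_eq, AffMap.negY_toFun_zero, AffMap.negY_toFun_one, neg_sq]
      exact ⟨h0, by linarith, hQ⟩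
    · rw [hτd]
      rintro _ ⟨p, ⟨hp, -⟩, rfl⟩
      rw [erad_negY]
      exact hD p hp
    · rw [hτd]
      exact wallLocus_transport AffMap.negY (by simp) (erad_negY κ₀ κ₁ a c)
        (fun i p => ((Fin.cons L ℓ : Fin (n + 1) → Wall) i).negY_eval p)
        (fun i hg => Wall.negY_gen _ hg) (fun j p => (q j).negY_eval p)
        (wallLocus_inter L hL (closure_neg_wall L) hfr)

/-- **STAGE 0: an open piece of `{κ₀X² + κ₁Y² < 1}`, every wall list** — cut along `X = 0`, the left half
by `negX` (`InBaker.of_Esector0` minus `goodWalls`). [KontsevichZagier2001 §1.2 rules (1)–(2); this node] -/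
theorem InBaker.of_Esector0' (hκ : 0 < κ₀ ∧ 0 < κ₁) (γ a c : ℚ) (ha : a ≠ 0) {n m : ℕ} (ℓ : Fin n → Wall)
    (q : Fin m → Wall) (σ : KZ.IntegralRep 2) (hσo : IsOpen σ.domain)
    (hσT : σ.domain ⊆ {w | (κ₀ : ℝ) * w 0 ^ 2 + κ₁ * w 1 ^ 2 < 1})
    (hD : ∀ w ∈ σ.domain, 0 < erad κ₀ κ₁ a c w)
    (hσi : ∀ w ∈ σ.domain, σ.integrand w = ellW κ₀ κ₁ γ a c w)
    (hfr : ∀ w ∈ closure σ.domain, w ∉ σ.domain → w ∈ wallLocus (erad κ₀ κ₁ a c) ℓ q) :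
    InBaker (KZ.of σ) := by
  set L : Wall := ⟨0, 1, 0⟩ with hLdef
  have hL : L.k1 ≠ 0 ∨ L.k2 ≠ 0 := Or.inl one_ne_zero
  have hLe : ∀ w : Fin 2 → ℝ, L.eval (w 0) (w 1) = w 0 := fun w => by
    simp only [hLdef, Wall.eval]; push_cast; ring
  have hb : Bornology.IsBounded σ.domain := isBounded_of_subset_ell hκ hσT
  refine InBaker.of_cut L hL σ (fun T hT hTr hTeq => ?_) fun T hT hTr hTeq => ?_
  · -- `X > 0`
    subst hTeq
    refine InBaker.of_Esector1' hκ γ a c ha (Fin.cons L ℓ) q (σ.restrict _ hT hTr)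
      (hσo.inter (isOpen_lt continuous_const L.continuous_eval)) (fun w hw => ?_) (fun w hw => hD w hw.1)
      (fun w hw => by rw [KZ.IntegralRep.integrand_restrict]; exact hσi w hw.1)
      (wallLocus_inter L hL (closure_pos_wall L) hfr)
    have hpos' : 0 < L.eval (w 0) (w 1) := hw.2
    rw [hLe] at hpos'
    exact ⟨hpos', hσT hw.1⟩
  · -- `X < 0`, by `negX`
    subst hTeq
    have hTo : IsOpen (σ.domain ∩ {w | L.eval (w 0) (w 1) < 0}) :=
      hσo.inter (isOpen_lt L.continuous_eval continuous_const)
    obtain ⟨τ, hτd, hτi⟩ := exists_ellRep (AffMap.negX.isSemialgebraic_image hT)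
      (AffMap.negX.isBounded_image (hb.subset hTr)) κ₀ κ₁ γ a c
    refine InBaker.of_negX κ₀ κ₁ γ a c (σ.restrict _ hT hTr) τ
      (by rw [hτd, KZ.IntegralRep.domain_restrict])
      (fun w hw => by rw [KZ.IntegralRep.integrand_restrict]; exact hσi w hw.1) hτi ?_
    refine InBaker.of_Esector1' hκ γ a c ha (fun i => ((Fin.cons L ℓ : Fin (n + 1) → Wall) i).negX)
      (fun j => (q j).negX) τ
      (by rw [hτd]; exact AffMap.negX.isOpen_image (by simp) hTo) ?_ ?_ hτi ?_
    · rw [hτd]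
      rintro _ ⟨p, ⟨hp, hneg⟩, rfl⟩
      have hQ := hσT hp
      have hneg' : L.eval (p 0) (p 1) < 0 := hneg
      rw [hLe] at hneg'
      simp only [mem_setOf_eq, AffMap.negX_toFun_zero, AffMap.negX_toFun_one, neg_sq] at hQ ⊢
      exact ⟨by linarith, hQ⟩
    · rw [hτd]
      rintro _ ⟨p, ⟨hp, -⟩, rfl⟩
      rw [erad_negX]
      exact hD p hp
    · rw [hτd]
      exact wallLocus_transport AffMap.negX (by simp) (erad_negX κ₀ κ₁ a c)
        (fun i p => ((Fin.cons L ℓ : Fin (n + 1) → Wall) i).negX_eval p)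
        (fun i hg => Wall.negX_gen _ hg) (fun j p => (q j).negX_eval p)
        (wallLocus_inter L hL (closure_neg_wall L) hfr)

/-! #### 63.3 Bounded pieces: the rational dilation -/

/-- **E-TYPE PLANE THEOREM (normal frame), EVERY WALL LIST.**  For `κ₀, κ₁ > 0`, `a ≠ 0` and a BOUNDED
open `ℚ`-semialgebraic `U` on which `a(κ₀X² + κ₁Y²) + c > 0`, whose frontier lies on the radicand conic, on
genuine rational lines `ℓ i` and on ANY adapted conic walls `a(κ₀X² + κ₁Y²) + c = (q j)²`:
`[U, γ√(a(κ₀X² + κ₁Y²) + c)] ∈ InBaker`.  A rational dilation `1/N` brings `U` inside `{Q < 1}`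
(`(γ, a, walls) ↦ (γN², aN², scaled walls)`), then `InBaker.of_Esector0'`.
[KontsevichZagier2001 §1.2 rules (1)–(3); this node] -/
theorem InBaker.of_Eplane' (hκ : 0 < κ₀ ∧ 0 < κ₁) (γ a c : ℚ) (ha : a ≠ 0) {n m : ℕ} (ℓ : Fin n → Wall)
    (q : Fin m → Wall) (σ : KZ.IntegralRep 2) (hσo : IsOpen σ.domain)
    (hσb : Bornology.IsBounded σ.domain) (hD : ∀ w ∈ σ.domain, 0 < erad κ₀ κ₁ a c w)
    (hσi : ∀ w ∈ σ.domain, σ.integrand w = ellW κ₀ κ₁ γ a c w)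
    (hfr : ∀ w ∈ closure σ.domain, w ∉ σ.domain → w ∈ wallLocus (erad κ₀ κ₁ a c) ℓ q) :
    InBaker (KZ.of σ) := by
  have hκ0 : (0 : ℝ) < κ₀ := by exact_mod_cast hκ.1
  have hκ1 : (0 : ℝ) < κ₁ := by exact_mod_cast hκ.2
  obtain ⟨R, hR⟩ := isBounded_iff_forall_norm_le.1 hσb
  have hw : ∀ w ∈ σ.domain, ∀ j, |w j| ≤ R := fun w hw j => by
    rw [← Real.norm_eq_abs]; exact (norm_le_pi_norm w j).trans (hR w hw)
  obtain ⟨N, hN⟩ := exists_nat_gt (((κ₀ : ℝ) + κ₁) * R ^ 2)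
  have hN0 : (0 : ℝ) < N := lt_of_le_of_lt (by positivity) hN
  have hN1 : (1 : ℝ) ≤ N := by
    exact_mod_cast Nat.one_le_iff_ne_zero.2 (by rintro rfl; simp at hN0)
  have hNq : (N : ℚ) ≠ 0 := by exact_mod_cast hN0.ne'
  have htl : (N : ℚ) * (1 / N) = 1 := by field_simp
  have hl0 : (1 / N : ℚ) ≠ 0 := one_div_ne_zero hNq
  have hdet : (AffMap.dil (1 / N : ℚ)).det ≠ 0 := by rw [AffMap.dil_det]; exact pow_ne_zero 2 hl0
  have hlR : ((1 / N : ℚ) : ℝ) = 1 / N := by rw [Rat.cast_div, Rat.cast_one, Rat.cast_natCast]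
  -- the dilated piece
  obtain ⟨τ, hτd, hτi⟩ := exists_ellRep
    ((AffMap.dil (1 / N : ℚ)).isSemialgebraic_image σ.isSemialgebraic_domain)
    ((AffMap.dil (1 / N : ℚ)).isBounded_image hσb) κ₀ κ₁ (γ * N ^ 2) (a * N ^ 2) c
  have hγ : γ * (N : ℚ) ^ 2 * (1 / N) ^ 2 = γ := by field_simp
  have ha2 : a * (N : ℚ) ^ 2 * (1 / N) ^ 2 = a := by field_simp
  refine InBaker.of_dil κ₀ κ₁ (γ * N ^ 2) (a * N ^ 2) c (1 / N) hl0 σ τ hτd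
    (fun p hp => by rw [hγ, ha2]; exact hσi p hp) hτi ?_
  refine InBaker.of_Esector0' hκ (γ * N ^ 2) (a * N ^ 2) c (mul_ne_zero ha (pow_ne_zero 2 hNq))
    (fun i => (ℓ i).scale N) (fun j => (q j).scale N) τ
    (by rw [hτd]; exact (AffMap.dil (1 / N : ℚ)).isOpen_image hdet hσo) ?_ ?_ hτi ?_
  · rw [hτd]
    rintro _ ⟨p, hp, rfl⟩
    have h0 : p 0 ^ 2 ≤ R ^ 2 := sq_le_sq' (abs_le.1 (hw p hp 0)).1 (abs_le.1 (hw p hp 0)).2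
    have h1 : p 1 ^ 2 ≤ R ^ 2 := sq_le_sq' (abs_le.1 (hw p hp 1)).1 (abs_le.1 (hw p hp 1)).2
    have hQ : (κ₀ : ℝ) * p 0 ^ 2 + κ₁ * p 1 ^ 2 ≤ (κ₀ + κ₁) * R ^ 2 := by nlinarith
    simp only [mem_setOf_eq, AffMap.dil_toFun_zero, AffMap.dil_toFun_one, hlR]
    rw [show (κ₀ : ℝ) * (1 / N * p 0) ^ 2 + κ₁ * (1 / N * p 1) ^ 2 =
      ((κ₀ : ℝ) * p 0 ^ 2 + κ₁ * p 1 ^ 2) / (N : ℝ) ^ 2 by field_simp]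
    rw [div_lt_one (by positivity)]
    nlinarith
  · rw [hτd]
    rintro _ ⟨p, hp, rfl⟩
    rw [erad_dil κ₀ κ₁ a c N (1 / N) htl]
    exact hD p hp
  · rw [hτd]
    exact wallLocus_transport (AffMap.dil (1 / N : ℚ)) hdet (erad_dil κ₀ κ₁ a c N (1 / N) htl)
      (fun i p => (ℓ i).scale_eval N (1 / N) htl p) (fun i hg => Wall.scale_gen _ hNq hg)
      (fun j p => (q j).scale_eval N (1 / N) htl p) hfr

end Summit.KontsevichZagierPeriods.RootDecompWalshStrata.ConicDescent.BallCube

end
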